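import Summits.QuantumFields.QCD.Theorems.QuarksAsStableActionStableActionBridgeDressedCoreDict
import Summits.QuantumFields.QCD.Theorems.QuarksAsStableActionStableActionBridgeFlavourBlocks
import HarnessLib

/-!
# Stub `stub_flavourChain_slice_dictionary` of line `pin-the-infimum` (crux `RobustYangMillsHandover`, 8892)

E2 (fermionic insertions in Lüscher's transfer form), layer W2-3a: **the `N_f`-flavour slice
dictionary.**  The landed γ0 layer (`stub_diracMatrix_source_timeSlice`) exhibits the
`N_f`-flavour `r = 1` Wilson–Dirac matrix with an equal-time source as a projector chain on the
slice index `(flavour × (ℤ/L)³) × colour × spin`, with explicit `Matrix.of` lifts: the projections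
`P± = ½(1 ± γ₄)` (`γ₄ := euclideanGamma 0`), the temporal transporter `W_t = ρ(U((t,y),0))`, the
flavour-block-diagonal slice operator `A_t` (mass `mq f + 4` on block `f` plus the spatial Wilson
hops) and the spin lift `B̂ = A(U_t) ⊗ 1₄` of its spin-blind block.  Smit's transfer-matrix
vocabulary (*Introduction to Quantum Fields on a Lattice*, §6.5 (6.74)–(6.77): `sliceMassHop` =
`A(U)`, `sliceDiracKinetic` = `D`, `sliceGaugeRot` = `G_g`, `sliceKron B Γ` = `B ⊗ Γ`) lives on
`SliceQuarkVar Nf L = flavour × ((ℤ/L)³ × colour × spin)`.  This file is the dictionary between the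
two along the re-association
`e = (Equiv.prodAssoc (Fin Nf) (TorusSite 3 L) (Fin 3 × Fin 4)).symm`:

* `P± = reindex e e (1 ⊗ P±)`, `W_t = reindex e e (sliceGaugeRot (U((t,·),0)))`,
  `A_t − B̂ = reindex e e ((1 ⊗ γ₄) D(U_t))` (entrywise; the kinetic remainder is reduced, flavour
  block by flavour block (`FlavourBlocks.*`), to the landed one-flavour dictionary
  `timeSlice_kinetic_dictionary`);
* the Wilson spin structure `B̂ P± = P± B̂`, `P±(A − B̂)P± = 0` (transport along the algebra
  isomorphism `reindex e e`, then `sliceKron` algebra and `P± γ_k P± = 0` for the spatial `γ_k`);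
* for masses `> −1`, `det B̂ = det A(U_t)⁴` is a unit (`sliceMassHop_posDef`) and
  `B̂⁻¹ = reindex e e (A(U_t)⁻¹ ⊗ 1₄)`.

Pure theorem file (no definitions); Mathlib plus the tree's `StableActionBridge.Sketch` bricks.

References: J. Smit, *Introduction to Quantum Fields on a Lattice* (CUP 2002/2023), §6.5
(6.74)–(6.77); M. Lüscher, Comm. Math. Phys. 54 (1977) 283–292.
-/

namespace Summit.QuantumFields.QCD.Cruxes.RobustYangMillsHandover.PinTheInfimum

open Literature.MathematicalPhysics.QuantumLattice Literature.MathematicalPhysics.QuantumFieldTheory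
open Literature.Probability.LatticeModels (TorusSite)
open Summit.QuantumFields.QCD.Cruxes.StableActionBridge.Sketch
open scoped ComplexOrder

namespace StubFlavourChainSliceDictionary

/-! ### The `4 × 4` spin algebra: `P± γ_k P± = 0` for the spatial `γ_k` -/

/-- `P⁺ γ_k P⁺ = 0` for `γ_k = euclideanGamma j.succ`: `γ₄ γ_k = −γ_k γ₄`, so
`(1 + γ₄) γ_k (1 + γ₄) = γ_k (1 − γ₄)(1 + γ₄) = 0`. [folklore] -/
theorem timeProjPlus_mul_gamma_mul_timeProjPlus (j : Fin 3) :
    timeProjPlus * euclideanGamma j.succ * timeProjPlus = 0 := by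
  -- adapted from `WilsonTransfer.projPlus_mul_gamma_mul_projPlus` (WilsonTransferForm.lean)
  have h0 : euclideanGamma 0 * euclideanGamma j.succ = -(euclideanGamma j.succ * euclideanGamma 0) :=
    euclideanGamma_mul_of_ne (Fin.succ_ne_zero j).symm
  have h : ((1 : Matrix (Fin 4) (Fin 4) ℂ) + euclideanGamma 0) * euclideanGamma j.succ *
      (1 + euclideanGamma 0) = 0 := by
    rw [add_mul, one_mul, h0, add_mul, neg_mul, mul_add, mul_add, mul_one, mul_one,
      Matrix.mul_assoc (euclideanGamma j.succ), euclideanGamma_mul_self, mul_one]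
    abel
  rw [timeProjPlus, Matrix.smul_mul, Matrix.smul_mul, Matrix.mul_smul, h, smul_zero, smul_zero]

/-- `P⁻ γ_k P⁻ = 0` for `γ_k = euclideanGamma j.succ`:
`(1 − γ₄) γ_k (1 − γ₄) = γ_k (1 + γ₄)(1 − γ₄) = 0`. [folklore] -/
theorem timeProjMinus_mul_gamma_mul_timeProjMinus (j : Fin 3) :
    timeProjMinus * euclideanGamma j.succ * timeProjMinus = 0 := by
  -- adapted from `SliceSpin.projMinus_mul_gamma_mul_projMinus` (SliceSpin.lean)
  have h0 : euclideanGamma 0 * euclideanGamma j.succ = -(euclideanGamma j.succ * euclideanGamma 0) :=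
    euclideanGamma_mul_of_ne (Fin.succ_ne_zero j).symm
  have h : ((1 : Matrix (Fin 4) (Fin 4) ℂ) - euclideanGamma 0) * euclideanGamma j.succ *
      (1 - euclideanGamma 0) = 0 := by
    rw [sub_mul, one_mul, h0, sub_neg_eq_add, add_mul, mul_sub, mul_sub, mul_one, mul_one,
      Matrix.mul_assoc (euclideanGamma j.succ), euclideanGamma_mul_self, mul_one]
    abel
  rw [timeProjMinus, Matrix.smul_mul, Matrix.smul_mul, Matrix.mul_smul, h, smul_zero, smul_zero]

/-! ### `P± ((1 ⊗ γ₄) D) P± = 0` in the `sliceKron` vocabulary -/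

variable {Nf S : ℕ} [NeZero S]

/-- `(1 ⊗ P⁺) ((1 ⊗ γ₄) D) (1 ⊗ P⁺) = 0`: `(1 ⊗ γ₄) D = ½∑ⱼ (W_j − W_jᴴ) ⊗ γ_j`
(`sliceKron_gammaZero_mul_sliceDiracKinetic`) and `P⁺ γ_j P⁺ = 0`.
[cite: Smit2023, §6.5 (6.74)–(6.77)] -/
theorem projPlus_gammaKinetic_projPlus (V : GaugeConfig 3 S (Matrix.specialUnitaryGroup (Fin 3) ℂ)) :
    sliceKron (Nf := Nf) (S := S) 1 timeProjPlus * (sliceKron 1 (euclideanGamma 0) * sliceDiracKinetic V) *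
        sliceKron 1 timeProjPlus = 0 := by
  rw [sliceKron_gammaZero_mul_sliceDiracKinetic, Matrix.mul_smul, Matrix.smul_mul, Finset.mul_sum,
    Finset.sum_mul]
  simp only [SliceNilpotent.sliceKron_mul, Matrix.one_mul, Matrix.mul_one,
    timeProjPlus_mul_gamma_mul_timeProjPlus, SliceNilpotent.sliceKron_zero_right,
    Finset.sum_const_zero, smul_zero]

/-- `(1 ⊗ P⁻) ((1 ⊗ γ₄) D) (1 ⊗ P⁻) = 0`: `(1 ⊗ γ₄) D = ½∑ⱼ (W_j − W_jᴴ) ⊗ γ_j` and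
`P⁻ γ_j P⁻ = 0`. [cite: Smit2023, §6.5 (6.74)–(6.77)] -/
theorem projMinus_gammaKinetic_projMinus (V : GaugeConfig 3 S (Matrix.specialUnitaryGroup (Fin 3) ℂ)) :
    sliceKron (Nf := Nf) (S := S) 1 timeProjMinus * (sliceKron 1 (euclideanGamma 0) * sliceDiracKinetic V) *
        sliceKron 1 timeProjMinus = 0 := by
  rw [sliceKron_gammaZero_mul_sliceDiracKinetic, Matrix.mul_smul, Matrix.smul_mul, Finset.mul_sum,
    Finset.sum_mul]
  simp only [SliceNilpotent.sliceKron_mul, Matrix.one_mul, Matrix.mul_one,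
    timeProjMinus_mul_gamma_mul_timeProjMinus, SliceNilpotent.sliceKron_zero_right,
    Finset.sum_const_zero, smul_zero]

/-! ### Dictionary along `e = (Equiv.prodAssoc flavour site (colour × spin)).symm` -/

/-- Entries of a reindexing along `e`: `(reindex e e M)_{((f,y),c,α),((g,z),d,β)} = M_{(f,y,c,α),(g,z,d,β)}`.
[folklore] -/
theorem reindex_prodAssoc_symm_apply (Nf L : ℕ) [NeZero L]
    (M : Matrix (SliceQuarkVar Nf L) (SliceQuarkVar Nf L) ℂ) (f g : Fin Nf) (y z : TorusSite 3 L)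
    (c d : Fin 3) (α β : Fin 4) :
    Matrix.reindex (Equiv.prodAssoc (Fin Nf) (TorusSite 3 L) (Fin 3 × Fin 4)).symm
        (Equiv.prodAssoc (Fin Nf) (TorusSite 3 L) (Fin 3 × Fin 4)).symm M ((f, y), c, α) ((g, z), d, β) =
      M (f, y, c, α) (g, z, d, β) := rfl

/-- **`1_X ⊗ 1_colour ⊗ P = reindex e e (1 ⊗ P)`**: the colour-blind lift of a `4 × 4` spin matrix
`P` on `(flavour × site) × colour × spin` is Smit's `sliceKron 1 P` re-associated along `e`.
[cite: Smit2023, §6.5 (6.74)–(6.77)] -/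
theorem spinLift_eq_reindex (Nf L : ℕ) [NeZero L] (P : Matrix (Fin 4) (Fin 4) ℂ) :
    (Matrix.of fun a b : (Fin Nf × TorusSite 3 L) × Fin 3 × Fin 4 =>
        if a.1 = b.1 ∧ a.2.1 = b.2.1 then P a.2.2 b.2.2 else 0) =
      Matrix.reindex (Equiv.prodAssoc (Fin Nf) (TorusSite 3 L) (Fin 3 × Fin 4)).symm
        (Equiv.prodAssoc (Fin Nf) (TorusSite 3 L) (Fin 3 × Fin 4)).symm
        (sliceKron (Nf := Nf) (S := L) 1 P) := by
  ext ⟨⟨f, y⟩, c, α⟩ ⟨⟨g, z⟩, d, β⟩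
  rw [reindex_prodAssoc_symm_apply]
  simp only [Matrix.of_apply, sliceKron, Matrix.one_apply, Prod.mk.injEq]
  by_cases hf : f = g <;> by_cases hy : y = z <;> by_cases hc : c = d <;> simp [hf, hy, hc]

/-- **`W = reindex e e (sliceGaugeRot g₀)`**: the flavour- and spin-blind colour transporter
`δ δ_{αβ} ρ(g₀ y)_{cd}` on `(flavour × site) × colour × spin` is Smit's one-particle gauge rotation
re-associated along `e` (`ρ` the fundamental representation of `SU(3)`).
[cite: Smit2023, §4.6 (4.124)–(4.126)] -/
theorem transporter_eq_reindex (Nf L : ℕ) [NeZero L]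
    (g₀ : TorusSite 3 L → Matrix.specialUnitaryGroup (Fin 3) ℂ) :
    (Matrix.of fun a b : (Fin Nf × TorusSite 3 L) × Fin 3 × Fin 4 =>
        if a.1 = b.1 ∧ a.2.2 = b.2.2 then fundamentalRep (Fin 3) (g₀ a.1.2) a.2.1 b.2.1 else 0) =
      Matrix.reindex (Equiv.prodAssoc (Fin Nf) (TorusSite 3 L) (Fin 3 × Fin 4)).symm
        (Equiv.prodAssoc (Fin Nf) (TorusSite 3 L) (Fin 3 × Fin 4)).symm
        (sliceGaugeRot (Nf := Nf) g₀) := by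
  ext ⟨⟨f, y⟩, c, α⟩ ⟨⟨g, z⟩, d, β⟩
  rw [reindex_prodAssoc_symm_apply]
  simp only [Matrix.of_apply, sliceGaugeRot, sliceKron, Matrix.one_apply, Prod.mk.injEq,
    fundamentalRep_apply]
  by_cases hf : f = g <;> by_cases hy : y = z <;> by_cases hα : α = β <;> simp [hf, hy, hα]

/-- **`A − B̂ = reindex e e ((1 ⊗ γ₄) D(U_t))`** for `N_f` flavours: the kinetic remainder of the
flavour-block-diagonal slice-`t` block `A` of the `r = 1` Wilson–Dirac operator (mass `mq f + 4` on
block `f`) over its spin-blind part `B̂ = reindex e e (A(U_t) ⊗ 1₄)` is Smit's `(1 ⊗ γ₄) D` of the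
slice configuration `U_t : e ↦ U((t, e.1), e.2.succ)`, re-associated along `e`.  Flavour block by
flavour block this is the landed one-flavour dictionary `timeSlice_kinetic_dictionary`; off the
flavour diagonal both sides vanish. [cite: Smit2023, §6.5 (6.74)–(6.75)] -/
theorem kineticRemainder_eq_reindex (Nf L : ℕ) [NeZero L]
    (U : GaugeConfig 4 L (Matrix.specialUnitaryGroup (Fin 3) ℂ)) (mq : Fin Nf → ℝ) (t : ZMod L) :
    (Matrix.of fun a b : (Fin Nf × TorusSite 3 L) × Fin 3 × Fin 4 => if a.1.1 = b.1.1 then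
          ((if a = b then ((mq a.1.1 + 4 * 1 : ℝ) : ℂ) else 0) -
            (1 / 2 : ℂ) * ∑ j : Fin 3,
              ((if b.1.2 = Literature.MathematicalPhysics.QuantumFieldTheory.Site.shift a.1.2 j then
                  (((1 : ℝ) : ℂ) • (1 : Matrix (Fin 4) (Fin 4) ℂ) - euclideanGamma j.succ) a.2.2 b.2.2 *
                    fundamentalRep (Fin 3) (U ((Fin.cons t a.1.2 : TorusSite 4 L), j.succ)) a.2.1 b.2.1 else 0) +
                (if a.1.2 = Literature.MathematicalPhysics.QuantumFieldTheory.Site.shift b.1.2 j then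
                  (((1 : ℝ) : ℂ) • (1 : Matrix (Fin 4) (Fin 4) ℂ) + euclideanGamma j.succ) a.2.2 b.2.2 *
                    fundamentalRep (Fin 3) (U ((Fin.cons t b.1.2 : TorusSite 4 L), j.succ))⁻¹ a.2.1 b.2.1 else 0)))
          else 0) -
        Matrix.reindex (Equiv.prodAssoc (Fin Nf) (TorusSite 3 L) (Fin 3 × Fin 4)).symm
          (Equiv.prodAssoc (Fin Nf) (TorusSite 3 L) (Fin 3 × Fin 4)).symm
          (sliceKron (sliceMassHop (fun e : Edge 3 L => U ((Fin.cons t e.1 : TorusSite 4 L), e.2.succ)) mq) 1) =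
      Matrix.reindex (Equiv.prodAssoc (Fin Nf) (TorusSite 3 L) (Fin 3 × Fin 4)).symm
        (Equiv.prodAssoc (Fin Nf) (TorusSite 3 L) (Fin 3 × Fin 4)).symm
        (sliceKron (Nf := Nf) (S := L) 1 (euclideanGamma 0) *
          sliceDiracKinetic (fun e : Edge 3 L => U ((Fin.cons t e.1 : TorusSite 4 L), e.2.succ))) := by
  ext ⟨⟨f, y⟩, c, α⟩ ⟨⟨g, z⟩, d, β⟩
  rw [Matrix.sub_apply, reindex_prodAssoc_symm_apply, reindex_prodAssoc_symm_apply, Matrix.of_apply,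
    FlavourBlocks.sliceKron_flavour (FlavourBlocks.sliceMassHop_flavour _ mq) 1,
    FlavourBlocks.mul_flavour (FlavourBlocks.sliceKron_one_flavour _)
      (FlavourBlocks.sliceDiracKinetic_flavour _)]
  by_cases hfg : f = g
  · -- diagonal flavour block `f`: the one-flavour dictionary with mass `mq f`
    subst hfg
    rw [if_pos rfl, if_pos rfl, if_pos rfl, sliceKron_gammaZero_mul_sliceDiracKinetic]
    refine Eq.trans ?_ (timeSlice_kinetic_dictionary L U (mq f) t (y, c, α) (z, d, β))
    rw [Matrix.sub_apply]
    congr 1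
    · simp only [Matrix.of_apply, Prod.mk.injEq, true_and]
    · rw [sliceKron_spinDiag_apply, sliceMassHop_timeSlice_apply]
      simp only [Matrix.of_apply]
  · -- off-diagonal flavour block: both sides vanish
    rw [if_neg hfg, if_neg hfg, if_neg hfg, sub_zero]

end StubFlavourChainSliceDictionary

/-- **E2 W2-3a: the `N_f`-flavour slice dictionary.**  For an `SU(3)` gauge field `U` on `(ℤ/L)⁴`,
masses `mq : Fin Nf → ℝ` and a time `t`, with the explicit `Matrix.of` lifts of the γ0 projector
chain on `(flavour × (ℤ/L)³) × colour × spin` — `P± = ½(1 ± γ₄)` on spin, the temporal transporter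
`W = ρ(U((t,y),0))` on colour, the flavour-block-diagonal `r = 1` Wilson slice operator `A`
(mass `mq f + 4` on block `f`) and `B̂ = reindex e e (A(U_t) ⊗ 1₄)` — and
`e = (Equiv.prodAssoc flavour site (colour × spin)).symm`, `U_t : e ↦ U((t, e.1), e.2.succ)`:
`P± = reindex e e (1 ⊗ P±)`, `W = reindex e e (sliceGaugeRot (U((t,·),0)))`,
`A − B̂ = reindex e e ((1 ⊗ γ₄) D(U_t))`, `B̂ P± = P± B̂`, `P±(A − B̂)P± = 0`, and for masses `> −1`
`det B̂` is a unit with `B̂⁻¹ = reindex e e (A(U_t)⁻¹ ⊗ 1₄)`.  The statement is the registered stub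
signature verbatim. [cite: Smit2023, §6.5 (6.74)–(6.77)] -/
theorem stub_flavourChain_slice_dictionary :
    ∀ (Nf L : ℕ) [NeZero L] (U : GaugeConfig 4 L (Matrix.specialUnitaryGroup (Fin 3) ℂ)) (mq : Fin Nf → ℝ) (t : ZMod L),
      let Pp : Matrix ((Fin Nf × TorusSite 3 L) × Fin 3 × Fin 4) ((Fin Nf × TorusSite 3 L) × Fin 3 × Fin 4) ℂ :=
        Matrix.of fun a b => if a.1 = b.1 ∧ a.2.1 = b.2.1 then ((1 / 2 : ℂ) • (1 + euclideanGamma 0)) a.2.2 b.2.2 else 0;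
      let Pm : Matrix ((Fin Nf × TorusSite 3 L) × Fin 3 × Fin 4) ((Fin Nf × TorusSite 3 L) × Fin 3 × Fin 4) ℂ :=
        Matrix.of fun a b => if a.1 = b.1 ∧ a.2.1 = b.2.1 then ((1 / 2 : ℂ) • (1 - euclideanGamma 0)) a.2.2 b.2.2 else 0;
      let W : Matrix ((Fin Nf × TorusSite 3 L) × Fin 3 × Fin 4) ((Fin Nf × TorusSite 3 L) × Fin 3 × Fin 4) ℂ :=
        Matrix.of fun a b => if a.1 = b.1 ∧ a.2.2 = b.2.2 then
          fundamentalRep (Fin 3) (U ((Fin.cons t a.1.2 : TorusSite 4 L), 0)) a.2.1 b.2.1 else 0;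
      let A : Matrix ((Fin Nf × TorusSite 3 L) × Fin 3 × Fin 4) ((Fin Nf × TorusSite 3 L) × Fin 3 × Fin 4) ℂ :=
        Matrix.of fun a b => if a.1.1 = b.1.1 then
          ((if a = b then ((mq a.1.1 + 4 * 1 : ℝ) : ℂ) else 0) -
            (1 / 2 : ℂ) * ∑ j : Fin 3,
              ((if b.1.2 = Literature.MathematicalPhysics.QuantumFieldTheory.Site.shift a.1.2 j then
                  (((1 : ℝ) : ℂ) • (1 : Matrix (Fin 4) (Fin 4) ℂ) - euclideanGamma j.succ) a.2.2 b.2.2 *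
                    fundamentalRep (Fin 3) (U ((Fin.cons t a.1.2 : TorusSite 4 L), j.succ)) a.2.1 b.2.1 else 0) +
                (if a.1.2 = Literature.MathematicalPhysics.QuantumFieldTheory.Site.shift b.1.2 j then
                  (((1 : ℝ) : ℂ) • (1 : Matrix (Fin 4) (Fin 4) ℂ) + euclideanGamma j.succ) a.2.2 b.2.2 *
                    fundamentalRep (Fin 3) (U ((Fin.cons t b.1.2 : TorusSite 4 L), j.succ))⁻¹ a.2.1 b.2.1 else 0)))
          else 0;
      let Bh : Matrix ((Fin Nf × TorusSite 3 L) × Fin 3 × Fin 4) ((Fin Nf × TorusSite 3 L) × Fin 3 × Fin 4) ℂ :=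
        Matrix.reindex (Equiv.prodAssoc (Fin Nf) (TorusSite 3 L) (Fin 3 × Fin 4)).symm
          (Equiv.prodAssoc (Fin Nf) (TorusSite 3 L) (Fin 3 × Fin 4)).symm
          (sliceKron (sliceMassHop (fun e : Edge 3 L => U ((Fin.cons t e.1 : TorusSite 4 L), e.2.succ)) mq) 1);
      Pp = Matrix.reindex (Equiv.prodAssoc (Fin Nf) (TorusSite 3 L) (Fin 3 × Fin 4)).symm
          (Equiv.prodAssoc (Fin Nf) (TorusSite 3 L) (Fin 3 × Fin 4)).symm (sliceKron (Nf := Nf) (S := L) 1 timeProjPlus) ∧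
      Pm = Matrix.reindex (Equiv.prodAssoc (Fin Nf) (TorusSite 3 L) (Fin 3 × Fin 4)).symm
          (Equiv.prodAssoc (Fin Nf) (TorusSite 3 L) (Fin 3 × Fin 4)).symm (sliceKron (Nf := Nf) (S := L) 1 timeProjMinus) ∧
      W = Matrix.reindex (Equiv.prodAssoc (Fin Nf) (TorusSite 3 L) (Fin 3 × Fin 4)).symm
          (Equiv.prodAssoc (Fin Nf) (TorusSite 3 L) (Fin 3 × Fin 4)).symm
          (sliceGaugeRot (Nf := Nf) (fun y : TorusSite 3 L => U ((Fin.cons t y : TorusSite 4 L), 0))) ∧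
      A - Bh = Matrix.reindex (Equiv.prodAssoc (Fin Nf) (TorusSite 3 L) (Fin 3 × Fin 4)).symm
          (Equiv.prodAssoc (Fin Nf) (TorusSite 3 L) (Fin 3 × Fin 4)).symm
          (sliceKron (Nf := Nf) (S := L) 1 (euclideanGamma 0) *
            sliceDiracKinetic (fun e : Edge 3 L => U ((Fin.cons t e.1 : TorusSite 4 L), e.2.succ))) ∧
      Bh * Pp = Pp * Bh ∧ Bh * Pm = Pm * Bh ∧ Pp * (A - Bh) * Pp = 0 ∧ Pm * (A - Bh) * Pm = 0 ∧
      ((∀ f, -1 < mq f) → IsUnit Bh.det ∧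
        Bh⁻¹ = Matrix.reindex (Equiv.prodAssoc (Fin Nf) (TorusSite 3 L) (Fin 3 × Fin 4)).symm
          (Equiv.prodAssoc (Fin Nf) (TorusSite 3 L) (Fin 3 × Fin 4)).symm
          (sliceKron ((sliceMassHop (fun e : Edge 3 L => U ((Fin.cons t e.1 : TorusSite 4 L), e.2.succ)) mq)⁻¹) 1)) := by
  intro Nf L _ U mq t Pp Pm W A Bh
  -- (1)–(4): the dictionary entries
  have hPp : Pp = Matrix.reindex (Equiv.prodAssoc (Fin Nf) (TorusSite 3 L) (Fin 3 × Fin 4)).symm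
      (Equiv.prodAssoc (Fin Nf) (TorusSite 3 L) (Fin 3 × Fin 4)).symm
      (sliceKron (Nf := Nf) (S := L) 1 timeProjPlus) :=
    StubFlavourChainSliceDictionary.spinLift_eq_reindex Nf L timeProjPlus
  have hPm : Pm = Matrix.reindex (Equiv.prodAssoc (Fin Nf) (TorusSite 3 L) (Fin 3 × Fin 4)).symm
      (Equiv.prodAssoc (Fin Nf) (TorusSite 3 L) (Fin 3 × Fin 4)).symm
      (sliceKron (Nf := Nf) (S := L) 1 timeProjMinus) :=
    StubFlavourChainSliceDictionary.spinLift_eq_reindex Nf L timeProjMinus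
  have hW : W = Matrix.reindex (Equiv.prodAssoc (Fin Nf) (TorusSite 3 L) (Fin 3 × Fin 4)).symm
      (Equiv.prodAssoc (Fin Nf) (TorusSite 3 L) (Fin 3 × Fin 4)).symm
      (sliceGaugeRot (Nf := Nf) (fun y : TorusSite 3 L => U ((Fin.cons t y : TorusSite 4 L), 0))) :=
    StubFlavourChainSliceDictionary.transporter_eq_reindex Nf L
      (fun y : TorusSite 3 L => U ((Fin.cons t y : TorusSite 4 L), 0))
  have hBh : Bh = Matrix.reindex (Equiv.prodAssoc (Fin Nf) (TorusSite 3 L) (Fin 3 × Fin 4)).symm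
      (Equiv.prodAssoc (Fin Nf) (TorusSite 3 L) (Fin 3 × Fin 4)).symm
      (sliceKron (sliceMassHop (fun e : Edge 3 L => U ((Fin.cons t e.1 : TorusSite 4 L), e.2.succ)) mq) 1) :=
    rfl
  have hAB : A - Bh = Matrix.reindex (Equiv.prodAssoc (Fin Nf) (TorusSite 3 L) (Fin 3 × Fin 4)).symm
      (Equiv.prodAssoc (Fin Nf) (TorusSite 3 L) (Fin 3 × Fin 4)).symm
      (sliceKron (Nf := Nf) (S := L) 1 (euclideanGamma 0) *
        sliceDiracKinetic (fun e : Edge 3 L => U ((Fin.cons t e.1 : TorusSite 4 L), e.2.succ))) :=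
    StubFlavourChainSliceDictionary.kineticRemainder_eq_reindex Nf L U mq t
  refine ⟨hPp, hPm, hW, hAB, ?_, ?_, ?_, ?_, ?_⟩
  · -- `B̂ P⁺ = P⁺ B̂`: `(A ⊗ 1)(1 ⊗ P⁺) = A ⊗ P⁺ = (1 ⊗ P⁺)(A ⊗ 1)`, transported along `e`
    rw [hBh, hPp]
    simp only [← Matrix.coe_reindexAlgEquiv ℂ ℂ, ← map_mul, (SliceNilpotent.sliceKron_one_comm _ _).1,
      (SliceNilpotent.sliceKron_one_comm _ _).2]
  · -- `B̂ P⁻ = P⁻ B̂`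
    rw [hBh, hPm]
    simp only [← Matrix.coe_reindexAlgEquiv ℂ ℂ, ← map_mul, (SliceNilpotent.sliceKron_one_comm _ _).1,
      (SliceNilpotent.sliceKron_one_comm _ _).2]
  · -- `P⁺ (A − B̂) P⁺ = 0`
    rw [hAB, hPp]
    simp only [← Matrix.coe_reindexAlgEquiv ℂ ℂ, ← map_mul,
      StubFlavourChainSliceDictionary.projPlus_gammaKinetic_projPlus, map_zero]
  · -- `P⁻ (A − B̂) P⁻ = 0`
    rw [hAB, hPm]
    simp only [← Matrix.coe_reindexAlgEquiv ℂ ℂ, ← map_mul,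
      StubFlavourChainSliceDictionary.projMinus_gammaKinetic_projMinus, map_zero]
  · -- invertibility for masses `> −1`: `det B̂ = det A(U_t)⁴`, `B̂⁻¹ = reindex e e (A(U_t)⁻¹ ⊗ 1)`
    intro hm
    have hdet : IsUnit (sliceMassHop (Nf := Nf)
        (fun e : Edge 3 L => U ((Fin.cons t e.1 : TorusSite 4 L), e.2.succ)) mq).det :=
      (Matrix.isUnit_iff_isUnit_det _).mp
        (sliceMassHop_posDef Nf L (fun e : Edge 3 L => U ((Fin.cons t e.1 : TorusSite 4 L), e.2.succ)) mq
          hm).isUnit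
    refine ⟨?_, ?_⟩
    · rw [hBh, Matrix.det_reindex_self, SliceNilpotent.det_sliceKron, Matrix.det_one, one_pow, mul_one]
      exact hdet.pow 4
    · rw [hBh, Matrix.inv_reindex, DressedCoreDict.sliceKron_one_inv]

end Summit.QuantumFields.QCD.Cruxes.RobustYangMillsHandover.PinTheInfimum
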